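import Literature.MathematicalPhysics.QuantumManyBody.GroundStateFeynmanKacFreeForm
import Literature.MathematicalPhysics.QuantumManyBody.PeriodicMultiplierKineticBound
import Literature.MathematicalPhysics.QuantumManyBody.DiluteBoseGasUpperBoundLocalization
import HarnessLib

/-!
# Crux `GroundStateRigidity` (stmt-AtomisticToContinuum-9072), line `Sketch`:
# helpers for the registered stub `stub_energyTrunc` (energy truncation `E₀(v ⊓ n) ↑ E₀(v)`)

Supports (does not close) stmt-AtomisticToContinuum-9072; auxiliary file of stub
`stub_energyTrunc` of line Sketch (lead c2), imported by
`BECCutLineWeakDisorderGroundStateRigidityStubEnergyTrunc.lean`. Contents (namespace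
`GroundStateRigidity.EnergyTrunc`): the normalisation of a `C¹` Dirichlet symmetric function to a
trial state (`exists_trialState_energy_le`); the pointwise and integrated FORM BOUND for a cut
state `f = χ g` (`form_pt_le`, `form_le`: IMS/Young multiplier bound
`kineticDensity_ofReal_mul_le` of the Literature for the kinetic part, and `V|f|² ≤ (V ⊓ n)|Ψ|²`
where the full and truncated interactions agree on `supp χ`); the pointwise and integrated MASS
BOUND `1 = ‖Ψ‖² ≤ (1+θ)‖f‖² + 2(1+θ⁻¹)(∫|g − Ψ|² + B² vol{χ ≠ 1})` (`mass_pt_le`, `mass_le`);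
and the real bookkeeping of the final parameter choice (`bookkeeping`). The registered landing
stub of this file is `stub_energyTruncCutStateForm` (= `EnergyTrunc.form_le`, binders explicit).
-/

noncomputable section

open MeasureTheory Filter Set
open scoped ENNReal NNReal Topology

namespace Summit.AtomisticToContinuum.BoseEinsteinCondensation.Theorems.GroundStateRigidity

open Literature.MathematicalPhysics.QuantumManyBody.BoseGas

namespace EnergyTrunc

variable {N : ℕ} {L : ℝ}

/-! ### Small facts -/

/-- The Dirichlet ground-state energy is monotone in the potential. [folklore] -/
theorem groundStateEnergy_mono {v w : ℝ → ℝ≥0∞} (h : ∀ r, v r ≤ w r) (N : ℕ) (L : ℝ) :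
    groundStateEnergy v N L ≤ groundStateEnergy w N L :=
  iInf_mono fun _ => lintegral_mono fun _ => add_le_add le_rfl
    (mul_le_mul' (Finset.sum_le_sum fun _ _ => Finset.sum_le_sum fun _ _ => h _) le_rfl)

/-- `(B : ℝ≥0∞)² = ofReal ((B : ℝ)²)` for `B : ℝ≥0`. [folklore] -/
theorem coe_nnreal_sq (B : ℝ≥0) : ((B : ℝ≥0∞)) ^ 2 = ENNReal.ofReal ((B : ℝ) ^ 2) := by
  rw [ENNReal.ofReal_pow B.coe_nonneg, ENNReal.ofReal_coe_nnreal]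

/-- Far from all collisions the truncated interaction is the full one: if all pairs are at
distance `> ε`, `v ≤ C` on `[ε, ∞)` and `C ≤ n`, then `∑ v = ∑ min(v, n)`. [folklore] -/
theorem interaction_eq_trunc {v : ℝ → ℝ≥0∞} {ε : ℝ} {C : ℝ≥0} {n : ℕ}
    (hC : ∀ s : ℝ, ε ≤ s → v s ≤ C) (hn : (C : ℝ≥0∞) ≤ n) {X : Config N}
    (hfar : ∀ i j : Fin N, i ≠ j → ε < dist (X i) (X j)) :
    interaction v X = interaction (fun r => min (v r) (n : ℝ≥0∞)) X := by
  unfold interaction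
  refine Finset.sum_congr rfl fun i _ => Finset.sum_congr rfl fun j hj => ?_
  have hij : i ≠ j := (Finset.mem_filter.1 hj).2.ne
  exact (min_eq_left ((hC _ (hfar i j hij).le).trans hn)).symm

/-! ### Normalising an admissible function -/

/-- **Normalisation.** If `G` is `C¹`, Dirichlet, symmetric with `0 < m = ∫|G|² < ⊤`, then `G/√m`
is a trial state of energy `≤ m⁻¹ Q_v(G)` (in fact `=`), for every `v`. [folklore] -/
theorem exists_trialState_energy_le {G : Config N → ℂ} (hG : ContDiff ℝ 1 G)
    (hG0 : ∀ X, X ∉ boxN N L → G X = 0)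
    (hGσ : ∀ (σ : Equiv.Perm (Fin N)) (X : Config N), G (X ∘ σ) = G X)
    (hm : ∫⁻ X, (‖G X‖₊ : ℝ≥0∞) ^ 2 ≠ 0) (hmt : ∫⁻ X, (‖G X‖₊ : ℝ≥0∞) ^ 2 ≠ ⊤)
    (v : ℝ → ℝ≥0∞) :
    ∃ Θ : TrialState N L, energy v Θ ≤ (∫⁻ X, (‖G X‖₊ : ℝ≥0∞) ^ 2)⁻¹ *
        ∫⁻ X, kineticDensity G X + interaction v X * (‖G X‖₊ : ℝ≥0∞) ^ 2 := by
  -- adapted from `GroundStateRigidity.ExistsNonneg.exists_trialState_of_le`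
  set m : ℝ≥0∞ := ∫⁻ X, (‖G X‖₊ : ℝ≥0∞) ^ 2 with hm_def
  set c : ℝ := Real.sqrt (m.toReal)⁻¹ with hc_def
  have hc2 : (‖(c : ℂ)‖₊ : ℝ≥0∞) ^ 2 = m⁻¹ := by
    rw [ennnorm_sq_eq_ofReal, Complex.norm_real, Real.norm_eq_abs, sq_abs, hc_def,
      Real.sq_sqrt (inv_nonneg.2 ENNReal.toReal_nonneg),
      ENNReal.ofReal_inv_of_pos (ENNReal.toReal_pos hm hmt), ENNReal.ofReal_toReal hmt]
  have hsq : ∀ X, (‖(c : ℂ) * G X‖₊ : ℝ≥0∞) ^ 2 = m⁻¹ * (‖G X‖₊ : ℝ≥0∞) ^ 2 := fun X => by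
    rw [nnnorm_mul, ENNReal.coe_mul, mul_pow, hc2]
  have hdiff : Differentiable ℝ G := hG.differentiable one_ne_zero
  refine ⟨⟨fun X => (c : ℂ) * G X, contDiff_const.mul hG, fun X hX => by simp [hG0 X hX],
    fun σ X => by rw [hGσ σ X], ?_⟩, ?_⟩
  · simp_rw [hsq]
    rw [lintegral_const_mul' _ _ (ENNReal.inv_ne_top.2 hm), ENNReal.inv_mul_cancel hm hmt]
  · have hk : ∀ X, kineticDensity (fun X => (c : ℂ) * G X) X = m⁻¹ * kineticDensity G X := by
      intro X
      simp only [kineticDensity, Finset.mul_sum]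
      refine Finset.sum_congr rfl fun i _ => Finset.sum_congr rfl fun k _ => ?_
      rw [((hdiff X).hasFDerivAt.const_mul (c : ℂ)).fderiv]
      change (‖(c : ℂ) • fderiv ℝ G X _‖₊ : ℝ≥0∞) ^ 2 = _
      rw [nnnorm_smul, ENNReal.coe_mul, mul_pow, hc2]
    simp only [energy, hk, hsq]
    rw [← lintegral_const_mul' _ _ (ENNReal.inv_ne_top.2 hm)]
    exact lintegral_mono fun X => le_of_eq (by ring)

/-! ### The cut state `f = χ g`: form bound and mass bound -/

section CutState

variable {v : ℝ → ℝ≥0∞} {n : ℕ} {g : Config N → ℂ} {χ : Config N → ℝ} {B : ℝ≥0} {θ : ℝ}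

/-- A `[0,1]`-valued real multiplier shrinks the modulus. [folklore] -/
theorem nnnorm_cut_le (hχ01 : ∀ X, 0 ≤ χ X ∧ χ X ≤ 1) (g : Config N → ℂ) (X : Config N) :
    ‖(χ X : ℂ) * g X‖₊ ≤ ‖g X‖₊ := by
  rw [nnnorm_mul, ← NNReal.coe_le_coe, NNReal.coe_mul, coe_nnnorm, coe_nnnorm, Complex.norm_real,
    Real.norm_eq_abs, abs_of_nonneg (hχ01 X).1]
  exact mul_le_of_le_one_left (norm_nonneg _) (hχ01 X).2

/-- **Pointwise form bound for the cut state** `f = χ g` against a trial state `Ψ` dominating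
`g` (`|g| ≤ |Ψ|`, `|∇g|² ≤ |∇Ψ|²`, `|g| ≤ B`, `g` Dirichlet), when the full interaction agrees with
the truncated one on `supp χ`: `|∇f|² + V|f|² ≤ (1+θ)(|∇Ψ|² + (V ⊓ n)|Ψ|²) + (1+θ⁻¹)B²|∇χ|² 1_{Λ^N}`
(IMS/Young multiplier bound `kineticDensity_ofReal_mul_le`). [cite: LSSY2005, proof of Thm 2.4] -/
theorem form_pt_le (Ψ : TrialState N L) (hg : ContDiff ℝ 1 g)
    (hg0 : ∀ X, X ∉ boxN N L → g X = 0) (hgB : ∀ X, ‖g X‖ ≤ B)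
    (hgΨ : ∀ X, ‖g X‖ ≤ ‖Ψ.ψ X‖) (hgk : ∀ X, kineticDensity g X ≤ kineticDensity Ψ.ψ X)
    (hχ : ContDiff ℝ 1 χ) (hχ01 : ∀ X, 0 ≤ χ X ∧ χ X ≤ 1)
    (hV : ∀ X, χ X ≠ 0 → interaction v X = interaction (fun r => min (v r) (n : ℝ≥0∞)) X)
    (hθ : 0 < θ) (X : Config N) :
    kineticDensity (fun Y => (χ Y : ℂ) * g Y) X +
        interaction v X * (‖(χ X : ℂ) * g X‖₊ : ℝ≥0∞) ^ 2 ≤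
      ENNReal.ofReal (1 + θ) * (kineticDensity Ψ.ψ X +
          interaction (fun r => min (v r) (n : ℝ≥0∞)) X * (‖Ψ.ψ X‖₊ : ℝ≥0∞) ^ 2) +
        ENNReal.ofReal (1 + θ⁻¹) * (B : ℝ≥0∞) ^ 2 * (boxN N L).indicator (realKinetic χ) X := by
  have hgd : Differentiable ℝ g := hg.differentiable one_ne_zero
  have hχd : Differentiable ℝ χ := hχ.differentiable one_ne_zero
  -- kinetic part
  have hkin := kineticDensity_ofReal_mul_le (hgd X) (hχd X) hθ
  have hA : ENNReal.ofReal ((1 + θ) * χ X ^ 2) * kineticDensity g X ≤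
      ENNReal.ofReal (1 + θ) * kineticDensity Ψ.ψ X := by
    refine mul_le_mul' (ENNReal.ofReal_le_ofReal ?_) (hgk X)
    have hχ2 : χ X ^ 2 ≤ 1 := by have := hχ01 X; nlinarith [this.1, this.2]
    nlinarith [hχ2]
  have hBd : ENNReal.ofReal (1 + θ⁻¹) * (‖g X‖₊ : ℝ≥0∞) ^ 2 *
        kineticDensity (fun Y => (χ Y : ℂ)) X ≤
      ENNReal.ofReal (1 + θ⁻¹) * (B : ℝ≥0∞) ^ 2 * (boxN N L).indicator (realKinetic χ) X := by
    rw [kineticDensity_ofReal hχd X]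
    by_cases hXb : X ∈ boxN N L
    · rw [indicator_of_mem hXb]
      refine mul_le_mul' (mul_le_mul' le_rfl (pow_le_pow_left' (ENNReal.coe_le_coe.2 ?_) 2)) le_rfl
      rw [← NNReal.coe_le_coe, coe_nnnorm]
      exact hgB X
    · rw [hg0 X hXb, nnnorm_zero, ENNReal.coe_zero, zero_pow two_ne_zero, mul_zero, zero_mul]
      exact bot_le
  -- potential part
  have hP : interaction v X * (‖(χ X : ℂ) * g X‖₊ : ℝ≥0∞) ^ 2 ≤
      ENNReal.ofReal (1 + θ) *
        (interaction (fun r => min (v r) (n : ℝ≥0∞)) X * (‖Ψ.ψ X‖₊ : ℝ≥0∞) ^ 2) := by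
    by_cases hχX : χ X = 0
    · simp [hχX]
    · rw [hV X hχX]
      have hθ1 : (1 : ℝ≥0∞) ≤ ENNReal.ofReal (1 + θ) := by
        rw [← ENNReal.ofReal_one]; exact ENNReal.ofReal_le_ofReal (by linarith)
      have hle : (‖(χ X : ℂ) * g X‖₊ : ℝ≥0∞) ≤ ‖Ψ.ψ X‖₊ := by
        refine ENNReal.coe_le_coe.2 ((nnnorm_cut_le hχ01 g X).trans ?_)
        rw [← NNReal.coe_le_coe, coe_nnnorm, coe_nnnorm]; exact hgΨ X
      calc _ ≤ interaction (fun r => min (v r) (n : ℝ≥0∞)) X * (‖Ψ.ψ X‖₊ : ℝ≥0∞) ^ 2 :=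
            mul_le_mul' le_rfl (pow_le_pow_left' hle 2)
        _ = 1 * _ := (one_mul _).symm
        _ ≤ _ := mul_le_mul' hθ1 le_rfl
  calc _ ≤ (ENNReal.ofReal (1 + θ) * kineticDensity Ψ.ψ X +
        ENNReal.ofReal (1 + θ⁻¹) * (B : ℝ≥0∞) ^ 2 * (boxN N L).indicator (realKinetic χ) X) +
        ENNReal.ofReal (1 + θ) *
          (interaction (fun r => min (v r) (n : ℝ≥0∞)) X * (‖Ψ.ψ X‖₊ : ℝ≥0∞) ^ 2) :=
        add_le_add (hkin.trans (add_le_add hA hBd)) hP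
    _ = _ := by ring

/-- **Form bound for the cut state** (integrated): `Q_v(χ g) ≤ (1+θ) 𝓔_{v ⊓ n}[Ψ] +
(1+θ⁻¹) B² ∫_{Λ^N} |∇χ|²`. [folklore] -/
theorem form_le (hv : Measurable v) (Ψ : TrialState N L) (hg : ContDiff ℝ 1 g)
    (hg0 : ∀ X, X ∉ boxN N L → g X = 0) (hgB : ∀ X, ‖g X‖ ≤ B)
    (hgΨ : ∀ X, ‖g X‖ ≤ ‖Ψ.ψ X‖) (hgk : ∀ X, kineticDensity g X ≤ kineticDensity Ψ.ψ X)
    (hχ : ContDiff ℝ 1 χ) (hχ01 : ∀ X, 0 ≤ χ X ∧ χ X ≤ 1)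
    (hV : ∀ X, χ X ≠ 0 → interaction v X = interaction (fun r => min (v r) (n : ℝ≥0∞)) X)
    (hθ : 0 < θ) :
    ∫⁻ X, kineticDensity (fun Y => (χ Y : ℂ) * g Y) X +
        interaction v X * (‖(χ X : ℂ) * g X‖₊ : ℝ≥0∞) ^ 2 ≤
      ENNReal.ofReal (1 + θ) * energy (fun r => min (v r) (n : ℝ≥0∞)) Ψ +
        ENNReal.ofReal (1 + θ⁻¹) * (B : ℝ≥0∞) ^ 2 * ∫⁻ X in boxN N L, realKinetic χ X := by
  have hmeas : Measurable fun X => ENNReal.ofReal (1 + θ) * (kineticDensity Ψ.ψ X +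
      interaction (fun r => min (v r) (n : ℝ≥0∞)) X * (‖Ψ.ψ X‖₊ : ℝ≥0∞) ^ 2) :=
    measurable_const.mul ((measurable_kineticDensity Ψ.contDiff).add
      ((measurable_interaction (hv.min measurable_const)).mul
        (measurable_normSq Ψ.contDiff.continuous)))
  calc _ ≤ ∫⁻ X, ENNReal.ofReal (1 + θ) * (kineticDensity Ψ.ψ X +
          interaction (fun r => min (v r) (n : ℝ≥0∞)) X * (‖Ψ.ψ X‖₊ : ℝ≥0∞) ^ 2) +
        ENNReal.ofReal (1 + θ⁻¹) * (B : ℝ≥0∞) ^ 2 * (boxN N L).indicator (realKinetic χ) X :=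
        lintegral_mono fun X => form_pt_le Ψ hg hg0 hgB hgΨ hgk hχ hχ01 hV hθ X
    _ = _ := by
        rw [lintegral_add_left hmeas, lintegral_const_mul' _ _ ENNReal.ofReal_ne_top,
          lintegral_const_mul' _ _ (ENNReal.mul_ne_top ENNReal.ofReal_ne_top
            (ENNReal.pow_ne_top ENNReal.coe_ne_top)),
          lintegral_indicator (measurableSet_boxN N L)]
        rfl

/-- **Pointwise mass bound**: with `f = χ g`, `S = {X ∈ Λ^N | χ X ≠ 1}`,
`|Ψ|² ≤ (1+θ)|f|² + 2(1+θ⁻¹)(|g − Ψ|² + B² 1_S)` (Young for `Ψ = f + (Ψ − f)` and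
`|Ψ − f| ≤ |g − Ψ| + |(1−χ) g|`, `|(1−χ)g| ≤ B 1_S` as `g` vanishes off the box). [folklore] -/
theorem mass_pt_le (Ψ : TrialState N L) (hg0 : ∀ X, X ∉ boxN N L → g X = 0)
    (hgB : ∀ X, ‖g X‖ ≤ B) (hχ01 : ∀ X, 0 ≤ χ X ∧ χ X ≤ 1) (hθ : 0 < θ) (X : Config N) :
    ((‖Ψ.ψ X‖₊ : ℝ≥0∞)) ^ 2 ≤
      ENNReal.ofReal (1 + θ) * (‖(χ X : ℂ) * g X‖₊ : ℝ≥0∞) ^ 2 +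
        ENNReal.ofReal (2 * (1 + θ⁻¹)) * ((‖g X - Ψ.ψ X‖₊ : ℝ≥0∞) ^ 2 +
          {X | X ∈ boxN N L ∧ χ X ≠ 1}.indicator (fun _ => ((B : ℝ≥0∞)) ^ 2) X) := by
  set S : Set (Config N) := {X | X ∈ boxN N L ∧ χ X ≠ 1} with hS
  set I : ℝ := S.indicator (fun _ => (B : ℝ) ^ 2) X with hI
  have hIE : S.indicator (fun _ => ((B : ℝ≥0∞)) ^ 2) X = ENNReal.ofReal I := by
    by_cases hX : X ∈ S
    · rw [hI, indicator_of_mem hX, indicator_of_mem hX, coe_nnreal_sq]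
    · rw [hI, indicator_of_notMem hX, indicator_of_notMem hX, ENNReal.ofReal_zero]
  have hI0 : 0 ≤ I := Set.indicator_nonneg (fun _ _ => sq_nonneg _) X
  -- `‖g - f‖² ≤ I`
  have hd : ‖g X - (χ X : ℂ) * g X‖ ^ 2 ≤ I := by
    by_cases hX : X ∈ S
    · rw [hI, indicator_of_mem hX]
      have h1 : g X - (χ X : ℂ) * g X = ((1 - χ X : ℝ) : ℂ) * g X := by push_cast; ring
      rw [h1, norm_mul, Complex.norm_real, Real.norm_eq_abs,
        abs_of_nonneg (by linarith [(hχ01 X).2])]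
      have h2 : (1 - χ X) * ‖g X‖ ≤ B :=
        (mul_le_of_le_one_left (norm_nonneg _) (by linarith [(hχ01 X).1])).trans (hgB X)
      exact pow_le_pow_left₀ (mul_nonneg (by linarith [(hχ01 X).2]) (norm_nonneg _)) h2 2
    · rw [hI, indicator_of_notMem hX]
      have h1 : g X - (χ X : ℂ) * g X = 0 := by
        by_cases hb : X ∈ boxN N L
        · have hc : χ X = 1 := by
            by_contra hc
            exact hX ⟨hb, hc⟩
          rw [hc]; push_cast; ring
        · rw [hg0 X hb]; ring
      rw [h1, norm_zero, zero_pow two_ne_zero]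
  -- Young + triangle
  have hy := norm_add_sq_le_young ((χ X : ℂ) * g X) (Ψ.ψ X - (χ X : ℂ) * g X) hθ
  rw [add_sub_cancel] at hy
  have htri : ‖Ψ.ψ X - (χ X : ℂ) * g X‖ ≤ ‖g X - Ψ.ψ X‖ + ‖g X - (χ X : ℂ) * g X‖ := by
    calc ‖Ψ.ψ X - (χ X : ℂ) * g X‖ = ‖(g X - (χ X : ℂ) * g X) - (g X - Ψ.ψ X)‖ := by
          congr 1; ring
      _ ≤ ‖g X - (χ X : ℂ) * g X‖ + ‖g X - Ψ.ψ X‖ := norm_sub_le _ _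
      _ = _ := add_comm _ _
  have hsq2 : ‖Ψ.ψ X - (χ X : ℂ) * g X‖ ^ 2 ≤ 2 * (‖g X - Ψ.ψ X‖ ^ 2 + I) := by
    have hc : ‖Ψ.ψ X - (χ X : ℂ) * g X‖ ^ 2 ≤ (‖g X - Ψ.ψ X‖ + ‖g X - (χ X : ℂ) * g X‖) ^ 2 :=
      pow_le_pow_left₀ (norm_nonneg _) htri 2
    nlinarith [hc, hd, sq_nonneg (‖g X - Ψ.ψ X‖ - ‖g X - (χ X : ℂ) * g X‖)]
  have h1 : 0 < 1 + θ⁻¹ := by positivity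
  have h3 := mul_le_mul_of_nonneg_left hsq2 h1.le
  have key : ‖Ψ.ψ X‖ ^ 2 ≤ (1 + θ) * ‖(χ X : ℂ) * g X‖ ^ 2 +
      2 * (1 + θ⁻¹) * (‖g X - Ψ.ψ X‖ ^ 2 + I) := by linarith
  rw [ennnorm_sq_eq_ofReal, ennnorm_sq_eq_ofReal, ennnorm_sq_eq_ofReal, hIE,
    ← ENNReal.ofReal_add (sq_nonneg _) hI0,
    ← ENNReal.ofReal_mul (by positivity), ← ENNReal.ofReal_mul (by positivity),
    ← ENNReal.ofReal_add (by positivity) (by positivity)]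
  exact ENNReal.ofReal_le_ofReal key

/-- **Mass bound for the cut state** (integrated):
`1 = ‖Ψ‖² ≤ (1+θ) ∫|χ g|² + 2(1+θ⁻¹)(∫|g − Ψ|² + B² vol{X ∈ Λ^N | χ X ≠ 1})`. [folklore] -/
theorem mass_le (Ψ : TrialState N L) (hg : ContDiff ℝ 1 g) (hg0 : ∀ X, X ∉ boxN N L → g X = 0)
    (hgB : ∀ X, ‖g X‖ ≤ B) (hχ : ContDiff ℝ 1 χ) (hχ01 : ∀ X, 0 ≤ χ X ∧ χ X ≤ 1)
    (hθ : 0 < θ) :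
    1 ≤ ENNReal.ofReal (1 + θ) * (∫⁻ X, (‖(χ X : ℂ) * g X‖₊ : ℝ≥0∞) ^ 2) +
      ENNReal.ofReal (2 * (1 + θ⁻¹)) * ((∫⁻ X, (‖g X - Ψ.ψ X‖₊ : ℝ≥0∞) ^ 2) +
        (B : ℝ≥0∞) ^ 2 * volume {X | X ∈ boxN N L ∧ χ X ≠ 1}) := by
  have hS : MeasurableSet {X | X ∈ boxN N L ∧ χ X ≠ 1} :=
    (measurableSet_boxN N L).inter (hχ.continuous.measurable (measurableSet_singleton 1).compl)
  have hfc : Continuous fun X => (χ X : ℂ) * g X :=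
    (Complex.continuous_ofReal.comp hχ.continuous).mul hg.continuous
  have hm1 : Measurable fun X => ENNReal.ofReal (1 + θ) * (‖(χ X : ℂ) * g X‖₊ : ℝ≥0∞) ^ 2 :=
    measurable_const.mul (measurable_normSq hfc)
  have hm2 : Measurable fun X => (‖g X - Ψ.ψ X‖₊ : ℝ≥0∞) ^ 2 :=
    measurable_normSq (hg.continuous.sub Ψ.contDiff.continuous)
  calc (1 : ℝ≥0∞) = ∫⁻ X, (‖Ψ.ψ X‖₊ : ℝ≥0∞) ^ 2 := Ψ.norm_eq.symm
    _ ≤ ∫⁻ X, ENNReal.ofReal (1 + θ) * (‖(χ X : ℂ) * g X‖₊ : ℝ≥0∞) ^ 2 +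
        ENNReal.ofReal (2 * (1 + θ⁻¹)) * ((‖g X - Ψ.ψ X‖₊ : ℝ≥0∞) ^ 2 +
          {X | X ∈ boxN N L ∧ χ X ≠ 1}.indicator (fun _ => ((B : ℝ≥0∞)) ^ 2) X) :=
        lintegral_mono fun X => mass_pt_le Ψ hg0 hgB hχ01 hθ X
    _ = _ := by
        rw [lintegral_add_left hm1, lintegral_const_mul' _ _ ENNReal.ofReal_ne_top,
          lintegral_const_mul' _ _ ENNReal.ofReal_ne_top, lintegral_add_left hm2,
          lintegral_indicator_const hS]

end CutState

/-! ### Real bookkeeping -/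

/-- **Real bookkeeping** for the parameter choice: with `θ(e+t+1) ≤ t/8`, `X(e+t+1) ≤ t/16`,
`Y(e+t+1) ≤ t/16`, the form bound `q ≤ (1+θ)(e + t/8) + X` and the mass bound
`1 ≤ (1+θ)μ + 2(Y + X)` give `μ > 0` and `q ≤ μ (e + t)`. [folklore] -/
theorem bookkeeping {e t θ X Y q μ : ℝ} (he : 0 ≤ e) (ht : 0 < t) (hθ0 : 0 < θ) (hθ1 : θ ≤ 1)
    (hθP : θ * (e + t + 1) ≤ t / 8) (hX0 : 0 ≤ X) (hXP : X * (e + t + 1) ≤ t / 16)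
    (hY0 : 0 ≤ Y) (hYP : Y * (e + t + 1) ≤ t / 16)
    (hq : q ≤ (1 + θ) * (e + t / 8) + X) (hμ : 1 ≤ (1 + θ) * μ + 2 * (Y + X)) :
    0 < μ ∧ q ≤ μ * (e + t) := by
  have hXe0 : 0 ≤ X * e := mul_nonneg hX0 he
  have hYe0 : 0 ≤ Y * e := mul_nonneg hY0 he
  have hX1 : X ≤ 1 / 16 := by
    by_contra h
    push Not at h
    linarith [mul_lt_mul_of_pos_right h ht]
  have hY1 : Y ≤ 1 / 16 := by
    by_contra h
    push Not at h
    linarith [mul_lt_mul_of_pos_right h ht]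
  have hXt : X ≤ t / 16 := by linarith [mul_nonneg hX0 ht.le]
  have hXe : X * (e + t) ≤ t / 16 := by linarith
  have hYe : Y * (e + t) ≤ t / 16 := by linarith
  have hμ1 : 3 / 4 ≤ (1 + θ) * μ := by linarith
  have hμ0 : 0 < μ := by
    by_contra h
    push Not at h
    linarith [mul_le_mul_of_nonneg_left h (by linarith : (0 : ℝ) ≤ 1 + θ)]
  refine ⟨hμ0, ?_⟩
  have h1a := mul_le_mul_of_nonneg_left hμ (by linarith : (0 : ℝ) ≤ e + t)
  have h1 : e + 3 * t / 4 ≤ (e + t) * ((1 + θ) * μ) := by linarith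
  have h21 : (1 + θ) * q ≤ (1 + θ) * ((1 + θ) * (e + t / 8) + X) :=
    mul_le_mul_of_nonneg_left hq (by linarith)
  have hθ2 : θ * θ ≤ θ := mul_le_of_le_one_right hθ0.le hθ1
  have het : 0 ≤ e + t / 8 := by linarith
  have hB1 : θ * (e + t / 8) ≤ t / 8 := by
    linarith [mul_le_mul_of_nonneg_left (show e + t / 8 ≤ e + t + 1 by linarith) hθ0.le]
  have hB2 : θ * θ * (e + t / 8) ≤ θ * (e + t / 8) := mul_le_mul_of_nonneg_right hθ2 het
  have hB3 : θ * X ≤ X := mul_le_of_le_one_left hX0 hθ1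
  have h2 : (1 + θ) * q ≤ e + 5 * t / 8 := by linarith
  by_contra h
  push Not at h
  linarith [mul_lt_mul_of_pos_left h (by linarith : (0 : ℝ) < 1 + θ)]

end EnergyTrunc

/-- **Registered landing stub of this support file** (`stub_energyTruncCutStateForm`, =
`EnergyTrunc.form_le` with all binders explicit): the `v`-form of the cut state `χ g` is at most
`(1+θ) 𝓔_{v ⊓ n}[Ψ] + (1+θ⁻¹) B² ∫_{Λ^N} |∇χ|²`. [cite: LSSY2005, proof of Thm 2.4] -/
theorem stub_energyTruncCutStateForm :
    ∀ (N : ℕ) (L : ℝ) (v : ℝ → ℝ≥0∞) (n : ℕ) (Ψ : TrialState N L) (g : Config N → ℂ)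
      (χ : Config N → ℝ) (B : ℝ≥0) (θ : ℝ), Measurable v → ContDiff ℝ 1 g →
      (∀ X, X ∉ boxN N L → g X = 0) → (∀ X, ‖g X‖ ≤ B) → (∀ X, ‖g X‖ ≤ ‖Ψ.ψ X‖) →
      (∀ X, kineticDensity g X ≤ kineticDensity Ψ.ψ X) → ContDiff ℝ 1 χ →
      (∀ X, 0 ≤ χ X ∧ χ X ≤ 1) →
      (∀ X, χ X ≠ 0 → interaction v X = interaction (fun r => min (v r) (n : ℝ≥0∞)) X) →
      0 < θ →
      ∫⁻ X, kineticDensity (fun Y => (χ Y : ℂ) * g Y) X +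
          interaction v X * (‖(χ X : ℂ) * g X‖₊ : ℝ≥0∞) ^ 2 ≤
        ENNReal.ofReal (1 + θ) * energy (fun r => min (v r) (n : ℝ≥0∞)) Ψ +
          ENNReal.ofReal (1 + θ⁻¹) * (B : ℝ≥0∞) ^ 2 * ∫⁻ X in boxN N L, realKinetic χ X :=
  fun _ _ _ _ Ψ _ _ _ _ hv hg hg0 hgB hgΨ hgk hχ hχ01 hV hθ =>
    EnergyTrunc.form_le hv Ψ hg hg0 hgB hgΨ hgk hχ hχ01 hV hθ

end Summit.AtomisticToContinuum.BoseEinsteinCondensation.Theorems.GroundStateRigidity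

end
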